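import Literature.NumberTheory.Transcendental.TubbsPeriodsConstruction
import Literature.NumberTheory.Transcendental.TubbsPeriodsIndependenceProofs
import Literature.NumberTheory.Transcendental.GelfondCriterionProofs
import HarnessLib

/-!
# Tubbs 1990, Theorem 4 (periods form): Gel'fond's criterion and the theorem — PROVED

Topic `Literature/NumberTheory/Transcendental` (trunk T-TRANSCEND). Last file of the discharge of
the named fact `Literature.NumberTheory.Transcendental.Tubbs1990_thm4_periods`
(`TubbsPeriodsIndependence.lean`; R. Tubbs, *Algebraic groups and small transcendence degree,
II*, J. Number Theory 35 (1990), Thm 4 p. 112 and Remark p. 114 = G. V. Chudnovsky,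
*Contributions to the theory of transcendental numbers* (1984), Ch. 7, Thm 4.1 (i), p. 318):

> for every lattice basis `(ω₁, ω₂)` of `ℂ` and every `c ≠ 0`,
> `trdeg_ℚ ℚ(g₂, g₃, ω₁, ω₂, c, e^{cω₁}, e^{cω₂}) ≥ 2`.

The level-`m` construction of `TubbsPeriodsConstruction.lean` gives, for a `Setup`
(`L`, `c ≠ 0`, `θ` transcendental, an envelope of `(ω₁, ω₂, c, e^{cω₁}, e^{cω₂}, e₁, g₂/2)` over
`ℚ(θ)`) and every large `m`, a polynomial `Q_m ∈ ℤ[T]` with `Q_m(θ) ≠ 0`,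
`deg Q_m ≤ K_δ m⁶`, `t(Q_m) ≤ K_σ m⁷` and `log |Q_m(θ)| ≤ K_v m¹³ - 2^{k_max} m¹⁴` (§1: the
crude conversion of the explicit bounds of `level_struct`, using `log x ≤ x`). Since
`m⁶ · m⁷ = m¹³ = o(m¹⁴)`, the tree's proved Gel'fond criterion
(`gelfond_criterion_not_small_values`, `GelfondCriterionProofs.lean`; Chudnovsky 1984, Ch. 4,
Lemma 1.1, with `a = 256`) yields the contradiction (`core`, §2). Finally (§3) the `θ`-form of the
theorem (`Tubbs1990_thm4_periods_of_thetaForm`, `TubbsPeriodsIndependenceProofs.lean`) is turned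
into a `Setup` (`BrownawellWaldschmidt.exists_envelope`; `e₁` is algebraic over `ℚ(θ)(g₂, g₃)`
by `4e₁³ - g₂e₁ - g₃ = 0`), which proves `Tubbs1990_thm4_periods_holds`.

Compared with the printed proofs (Tubbs §5: Philippon's zero estimate on `𝔾ₐ × 𝔾ₘ × E`;
Chudnovsky: "the proof is a stereotype"), the zero estimate is replaced by the elementary
extrapolation of `TubbsPeriodsConstruction.exists_small_value` and Tijdeman's lemma
(`TubbsPeriodsTaylor.lean`); this is possible because Chudnovsky's parameters (p. 318) leave
polynomial room in Gel'fond's criterion ("the transcendence type of `K` is not less than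
`2 + 1/3`").

## References

* R. Tubbs, J. Number Theory 35 (1990), Thm 4 (p. 112), Remark p. 114, §5. [Tubbs1990]
* G. V. Chudnovsky, *Contributions to the theory of transcendental numbers* (1984), Ch. 7,
  Thm 4.1 (i), p. 318; Ch. 4, Lemma 1.1, p. 177. [Chudnovsky1984]
-/

noncomputable section

open scoped Polynomial Nat IntermediateField
open Complex Finset Filter Topology

namespace Literature.NumberTheory.Transcendental.TubbsPeriods

open Literature.NumberTheory.Transcendental.Chudnovsky (zl1 supNorm_le_zl1 e₁ e₁_cubic)
open Literature.NumberTheory.Transcendental.BrownawellWaldschmidt (Envelope exists_envelope)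

/-! ### §0 Crude real-variable bookkeeping (`log x ≤ x`) -/

section Crude

/-- `B^e ≤ exp(e κ)` if `log B ≤ κ` and `B ≥ 1`... in fact only `0 < B` is needed. [folklore] -/
lemma pow_le_exp_of_log_le {B κ : ℝ} (hB : 0 < B) (e : ℕ) (hlog : Real.log B ≤ κ) :
    B ^ e ≤ Real.exp (e * κ) := by
  have h1 : B ^ e = Real.exp (e * Real.log B) := by
    rw [Real.exp_nat_mul, Real.exp_log hB]
  rw [h1]
  exact Real.exp_le_exp.mpr (mul_le_mul_of_nonneg_left hlog (Nat.cast_nonneg _))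

/-- `log (C m^k) ≤ C + k m` for `C ≥ 1`, `m ≥ 1`. [folklore] -/
lemma log_const_mul_pow_le {C : ℝ} (hC : 1 ≤ C) (k : ℕ) {m : ℝ} (hm : 1 ≤ m) :
    Real.log (C * m ^ k) ≤ C + k * m := by
  have hC0 : 0 < C := by linarith
  have hm0 : 0 < m := by linarith
  rw [Real.log_mul hC0.ne' (pow_pos hm0 k).ne', Real.log_pow]
  have h1 : Real.log C ≤ C := Real.log_le_self hC0.le
  have h2 : Real.log m ≤ m := Real.log_le_self hm0.le
  have hk : (0 : ℝ) ≤ k := Nat.cast_nonneg _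
  nlinarith

/-- `N! ≤ exp(N²)` (`N! ≤ N^N`, `log N ≤ N`). [folklore] -/
lemma factorial_le_exp_sq (N : ℕ) : ((N ! : ℕ) : ℝ) ≤ Real.exp ((N : ℝ) ^ 2) := by
  rcases Nat.eq_zero_or_pos N with rfl | hN
  · simp
  have h1 : ((N ! : ℕ) : ℝ) ≤ (N : ℝ) ^ N := by exact_mod_cast Nat.factorial_le_pow N
  refine h1.trans ?_
  have hN' : (0 : ℝ) < N := by exact_mod_cast hN
  refine (pow_le_exp_of_log_le hN' N le_rfl).trans ?_
  refine Real.exp_le_exp.mpr ?_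
  have := Real.log_le_self hN'.le
  rw [sq]
  exact mul_le_mul_of_nonneg_left this hN'.le

end Crude

namespace Setup

variable (S : Setup)

/-! ### §1 The bounds at level `m` in exponential form -/

section LevelBounds

variable (m : ℕ)

/-- `Θ = max(1, |θ|)`. [folklore] -/
def Θθ : ℝ := max 1 ‖S.θ‖

/-- `1 ≤ Θ`. [folklore] -/
lemma one_le_Θθ : 1 ≤ S.Θθ := le_max_left _ _

/-- `#Λ = C_a m¹⁴`. [folklore] -/
lemma card_Λ : (Fintype.card (S.Λ m) : ℝ) = S.Ca * (m : ℝ) ^ 14 := by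
  simp only [Fintype.card_prod, Fintype.card_fin]
  unfold La L0 L1
  push_cast
  ring

/-- `#Λ ≤ exp((C_a + 14) m⁷)` (`m ≥ 1`). [folklore] -/
lemma card_le_exp (hm : 1 ≤ m) :
    (Fintype.card (S.Λ m) : ℝ) ≤ Real.exp ((S.Ca + 14) * (m : ℝ) ^ 7) := by
  have hm1 : (1 : ℝ) ≤ m := by exact_mod_cast hm
  have hCa : (1 : ℝ) ≤ S.Ca := by exact_mod_cast S.one_le_Ca
  rw [S.card_Λ m]
  have hpos : 0 < (S.Ca : ℝ) * (m : ℝ) ^ 14 := by positivity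
  have hlog := log_const_mul_pow_le hCa 14 hm1
  calc (S.Ca : ℝ) * (m : ℝ) ^ 14 = Real.exp (Real.log ((S.Ca : ℝ) * (m : ℝ) ^ 14)) := (Real.exp_log hpos).symm
    _ ≤ Real.exp (S.Ca + 14 * m) := Real.exp_le_exp.mpr (by exact_mod_cast hlog)
    _ ≤ Real.exp ((S.Ca + 14) * (m : ℝ) ^ 7) := by
        refine Real.exp_le_exp.mpr ?_
        have h7 : (m : ℝ) ≤ (m : ℝ) ^ 7 := by
          calc (m : ℝ) = (m : ℝ) ^ 1 := (pow_one _).symm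
            _ ≤ (m : ℝ) ^ 7 := pow_le_pow_right₀ hm1 (by norm_num)
        have h7' : (1 : ℝ) ≤ (m : ℝ) ^ 7 := one_le_pow₀ hm1
        have hCa0 : (0:ℝ) ≤ S.Ca := Nat.cast_nonneg _
        nlinarith

/-- `κ_A = C_n δ₀ + 1`: `A₀ ≤ κ_A m⁶`. [folklore] -/
def κA : ℝ := S.Cn * S.δ₀ + 1

/-- `1 ≤ κ_A`. [folklore] -/
lemma one_le_κA : 1 ≤ S.κA := by
  unfold κA
  have : (0:ℝ) ≤ S.Cn * S.δ₀ := by positivity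
  linarith

/-- `A₀ ≤ κ_A m⁶` (`m ≥ 1`). [folklore] -/
lemma A₀_le (hm : 1 ≤ m) : (S.A₀ m : ℝ) ≤ S.κA * (m : ℝ) ^ 6 := by
  have hm1 : (1 : ℝ) ≤ m := by exact_mod_cast hm
  have h6 : (1 : ℝ) ≤ (m : ℝ) ^ 6 := one_le_pow₀ hm1
  unfold A₀ nDeg κA
  push_cast
  nlinarith [show (0:ℝ) ≤ S.Cn * S.δ₀ by positivity]

/-- `A₀ ≤ exp(κ_A m⁷)` (`m ≥ 1`). [folklore] -/
lemma A₀_le_exp (hm : 1 ≤ m) : (S.A₀ m : ℝ) ≤ Real.exp (S.κA * (m : ℝ) ^ 7) := by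
  have hm1 : (1 : ℝ) ≤ m := by exact_mod_cast hm
  have hle : S.κA * (m : ℝ) ^ 6 ≤ Real.exp (S.κA * (m : ℝ) ^ 6) := by
    linarith [Real.add_one_le_exp (S.κA * (m : ℝ) ^ 6)]
  refine (S.A₀_le m hm).trans (hle.trans (Real.exp_le_exp.mpr ?_))
  exact mul_le_mul_of_nonneg_left (pow_le_pow_right₀ hm1 (by norm_num)) (le_trans zero_le_one S.one_le_κA)

/-- `κ_l = K₁(26C_n + 6) + C_n(3K₂ + 4)`: `l1B ≤ exp(κ_l m⁷)`. [folklore] -/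
def κl : ℝ := S.K₁ * (26 * S.Cn + 6) + S.Cn * (3 * S.K2 + 4)

/-- `0 ≤ κ_l`. [folklore] -/
lemma κl_nonneg : 0 ≤ S.κl := by unfold κl; positivity

/-- `l1B ≤ exp(κ_l m⁷)` (`m ≥ 1`). [folklore] -/
lemma l1B_le_exp (hm : 1 ≤ m) : S.l1B m ≤ Real.exp (S.κl * (m : ℝ) ^ 7) := by
  have hm1 : (1 : ℝ) ≤ m := by exact_mod_cast hm
  have hm0 : (0 : ℝ) < m := by linarith
  have hCn : (1 : ℝ) ≤ S.Cn := by exact_mod_cast S.one_le_Cn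
  have hK2 : (1 : ℝ) ≤ S.K2 := by exact_mod_cast S.one_le_K2
  -- first factor
  have hb1 : (1 : ℝ) ≤ (26 * S.Cn : ℕ) := by push_cast; linarith
  have hb1' : 0 < ((26 * S.Cn : ℕ) : ℝ) * (m : ℝ) ^ 6 := by positivity
  have hlog1 : Real.log (((26 * S.Cn : ℕ) : ℝ) * (m : ℝ) ^ 6) ≤ 26 * S.Cn + 6 * m := by
    have := log_const_mul_pow_le hb1 6 hm1
    push_cast at this ⊢
    linarith
  have h1 : (((26 * S.Cn : ℕ) : ℝ) * (m : ℝ) ^ 6) ^ S.T m ≤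
      Real.exp (S.K₁ * (26 * S.Cn + 6) * (m : ℝ) ^ 7) := by
    refine (pow_le_exp_of_log_le hb1' (S.T m) hlog1).trans (Real.exp_le_exp.mpr ?_)
    have hT : ((S.T m : ℕ) : ℝ) = S.K₁ * (m : ℝ) ^ 6 := by unfold T; push_cast; ring
    rw [hT]
    have h7 : (m : ℝ) ^ 6 ≤ (m : ℝ) ^ 7 := pow_le_pow_right₀ hm1 (by norm_num)
    have hK₁ : (0 : ℝ) ≤ S.K₁ := Nat.cast_nonneg _
    have e1 : S.K₁ * (m : ℝ) ^ 6 * (26 * S.Cn + 6 * m) =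
        S.K₁ * (26 * S.Cn) * (m : ℝ) ^ 6 + S.K₁ * 6 * (m : ℝ) ^ 7 := by ring
    rw [e1]
    nlinarith [mul_le_mul_of_nonneg_left h7 (by positivity : (0:ℝ) ≤ S.K₁ * (26 * S.Cn))]
  -- second factor
  have hb2 : ((2 * S.K2 : ℕ) : ℝ) * (m : ℝ) ^ 4 + 1 ≤ (3 * S.K2) * (m : ℝ) ^ 4 := by
    push_cast
    have : (1 : ℝ) ≤ S.K2 * (m : ℝ) ^ 4 := one_le_mul_of_one_le_of_one_le hK2 (one_le_pow₀ hm1)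
    linarith
  have hb2pos : 0 < ((2 * S.K2 : ℕ) : ℝ) * (m : ℝ) ^ 4 + 1 := by positivity
  have hlog2 : Real.log (((2 * S.K2 : ℕ) : ℝ) * (m : ℝ) ^ 4 + 1) ≤ 3 * S.K2 + 4 * m := by
    refine (Real.log_le_log hb2pos hb2).trans ?_
    have := log_const_mul_pow_le (show (1:ℝ) ≤ 3 * S.K2 by linarith) 4 hm1
    push_cast at this ⊢
    linarith
  have h2 : (((2 * S.K2 : ℕ) : ℝ) * (m : ℝ) ^ 4 + 1) ^ S.nDeg m ≤
      Real.exp (S.Cn * (3 * S.K2 + 4) * (m : ℝ) ^ 7) := by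
    refine (pow_le_exp_of_log_le hb2pos (S.nDeg m) hlog2).trans (Real.exp_le_exp.mpr ?_)
    have hn : ((S.nDeg m : ℕ) : ℝ) = S.Cn * (m : ℝ) ^ 6 := by unfold nDeg; push_cast; ring
    rw [hn]
    have h7 : (m : ℝ) ^ 6 ≤ (m : ℝ) ^ 7 := pow_le_pow_right₀ hm1 (by norm_num)
    have e1 : S.Cn * (m : ℝ) ^ 6 * (3 * S.K2 + 4 * m) =
        S.Cn * (3 * S.K2) * (m : ℝ) ^ 6 + S.Cn * 4 * (m : ℝ) ^ 7 := by ring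
    rw [e1]
    nlinarith [mul_le_mul_of_nonneg_left h7 (by positivity : (0:ℝ) ≤ S.Cn * (3 * S.K2))]
  unfold l1B
  calc _ ≤ Real.exp (S.K₁ * (26 * S.Cn + 6) * (m : ℝ) ^ 7) * Real.exp (S.Cn * (3 * S.K2 + 4) * (m : ℝ) ^ 7) :=
        mul_le_mul h1 h2 (by positivity) (by positivity)
    _ = Real.exp (S.κl * (m : ℝ) ^ 7) := by rw [← Real.exp_add]; unfold κl; ring_nf

/-- `d⁷ (dH₀)^n ≤ exp((7d + C_n d H₀) m⁷)` (`m ≥ 1`). [folklore] -/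
lemma dd_le_exp (hm : 1 ≤ m) :
    (S.d : ℝ) ^ 7 * (S.d * S.H₀) ^ S.nDeg m ≤ Real.exp ((7 * S.d + S.Cn * S.d * S.H₀) * (m : ℝ) ^ 7) := by
  have hm1 : (1 : ℝ) ≤ m := by exact_mod_cast hm
  have hd : (1 : ℝ) ≤ S.d := by exact_mod_cast S.one_le_d
  have hd0 : (0 : ℝ) < S.d := by linarith
  have hdH : (1 : ℝ) ≤ S.d * S.H₀ := one_le_mul_of_one_le_of_one_le hd S.one_le_H₀
  have h1 : (S.d : ℝ) ^ 7 ≤ Real.exp (7 * S.d * (m : ℝ) ^ 7) := by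
    refine (pow_le_exp_of_log_le hd0 7 (Real.log_le_self hd0.le)).trans (Real.exp_le_exp.mpr ?_)
    have h7 : (1 : ℝ) ≤ (m : ℝ) ^ 7 := one_le_pow₀ hm1
    push_cast
    nlinarith
  have h2 : (S.d * S.H₀) ^ S.nDeg m ≤ Real.exp (S.Cn * S.d * S.H₀ * (m : ℝ) ^ 7) := by
    refine (pow_le_exp_of_log_le (by linarith) (S.nDeg m) (Real.log_le_self (by linarith))).trans
      (Real.exp_le_exp.mpr ?_)
    have hn : ((S.nDeg m : ℕ) : ℝ) = S.Cn * (m : ℝ) ^ 6 := by unfold nDeg; push_cast; ring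
    rw [hn]
    have h7 : (m : ℝ) ^ 6 ≤ (m : ℝ) ^ 7 := pow_le_pow_right₀ hm1 (by norm_num)
    nlinarith [mul_le_mul_of_nonneg_left h7 (by positivity : (0:ℝ) ≤ S.Cn * (S.d * S.H₀))]
  calc _ ≤ Real.exp (7 * S.d * (m : ℝ) ^ 7) * Real.exp (S.Cn * S.d * S.H₀ * (m : ℝ) ^ 7) :=
        mul_le_mul h1 h2 (by positivity) (by positivity)
    _ = _ := by rw [← Real.exp_add]; ring_nf

/-- `κ_H`: `H_Y ≤ exp(κ_H m⁷)`. [folklore] -/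
def κH : ℝ := 2 * (S.Ca + 14) + 2 * S.κA + 2 * S.κl + 2 * (7 * S.d + S.Cn * S.d * S.H₀)

/-- `0 ≤ κ_H`. [folklore] -/
lemma κH_nonneg : 0 ≤ S.κH := by
  unfold κH
  have := S.one_le_κA
  have := S.κl_nonneg
  have := S.H₀_nonneg
  positivity

/-- `CfB ≤ exp((κ_c + κ_A + κ_l + κ_dd) m⁷)` (`m ≥ 1`). [folklore] -/
lemma CfB_le_exp (hm : 1 ≤ m) :
    S.CfB m ≤ Real.exp (((S.Ca + 14) + S.κA + S.κl + (7 * S.d + S.Cn * S.d * S.H₀)) * (m : ℝ) ^ 7) := by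
  unfold CfB Bsieg
  have h1 := S.card_le_exp m hm
  have h2 := S.A₀_le_exp m hm
  have h3 := S.l1B_le_exp m hm
  have h4 := S.dd_le_exp m hm
  have hl0 : 0 ≤ S.l1B m := le_trans zero_le_one (S.one_le_l1B m hm)
  have hH := S.H₀_nonneg
  calc (Fintype.card (S.Λ m) : ℝ) * S.A₀ m * (S.l1B m * ((S.d : ℝ) ^ 7 * (S.d * S.H₀) ^ S.nDeg m))
      ≤ Real.exp ((S.Ca + 14) * (m : ℝ) ^ 7) * Real.exp (S.κA * (m : ℝ) ^ 7) *
        (Real.exp (S.κl * (m : ℝ) ^ 7) * Real.exp ((7 * S.d + S.Cn * S.d * S.H₀) * (m : ℝ) ^ 7)) := by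
        gcongr
    _ = _ := by rw [← Real.exp_add, ← Real.exp_add, ← Real.exp_add]; ring_nf

/-- `H_Y ≤ exp(κ_H m⁷)` (`m ≥ 1`). [folklore] -/
lemma HY_le_exp (hm : 1 ≤ m) : S.HY m ≤ Real.exp (S.κH * (m : ℝ) ^ 7) := by
  unfold HY
  have h1 := S.card_le_exp m hm
  have h2 := S.A₀_le_exp m hm
  have h3 := S.l1B_le_exp m hm
  have h4 := S.dd_le_exp m hm
  have h5 := S.CfB_le_exp m hm
  have hl0 : 0 ≤ S.l1B m := le_trans zero_le_one (S.one_le_l1B m hm)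
  have hH := S.H₀_nonneg
  have hCfB0 : 0 ≤ S.CfB m := by
    unfold CfB Bsieg; positivity
  calc (Fintype.card (S.Λ m) : ℝ) * (S.A₀ m * S.CfB m) * S.l1B m * ((S.d : ℝ) ^ 7 * (S.d * S.H₀) ^ S.nDeg m)
      ≤ Real.exp ((S.Ca + 14) * (m : ℝ) ^ 7) * (Real.exp (S.κA * (m : ℝ) ^ 7) *
          Real.exp (((S.Ca + 14) + S.κA + S.κl + (7 * S.d + S.Cn * S.d * S.H₀)) * (m : ℝ) ^ 7)) *
        Real.exp (S.κl * (m : ℝ) ^ 7) * Real.exp ((7 * S.d + S.Cn * S.d * S.H₀) * (m : ℝ) ^ 7) := by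
        gcongr
    _ = Real.exp (S.κH * (m : ℝ) ^ 7) := by
        rw [← Real.exp_add, ← Real.exp_add, ← Real.exp_add, ← Real.exp_add]; unfold κH; ring_nf

/-- `1 ≤ H_Y` (`m ≥ 1`). [folklore] -/
lemma one_le_HY (hm : 1 ≤ m) : 1 ≤ S.HY m := by
  unfold HY CfB Bsieg
  have hcard : (1 : ℝ) ≤ Fintype.card (S.Λ m) := by
    rw [S.card_Λ m]
    have hm1 : (1 : ℝ) ≤ m := by exact_mod_cast hm
    have hCa : (1 : ℝ) ≤ S.Ca := by exact_mod_cast S.one_le_Ca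
    exact one_le_mul_of_one_le_of_one_le hCa (one_le_pow₀ hm1)
  have hA : (1 : ℝ) ≤ S.A₀ m := by unfold A₀; exact_mod_cast Nat.le_add_left 1 _
  have hl := S.one_le_l1B m hm
  have hd : (1 : ℝ) ≤ S.d := by exact_mod_cast S.one_le_d
  have hdH : (1 : ℝ) ≤ S.d * S.H₀ := one_le_mul_of_one_le_of_one_le hd S.one_le_H₀
  have hdd : (1 : ℝ) ≤ (S.d : ℝ) ^ 7 * (S.d * S.H₀) ^ S.nDeg m :=
    one_le_mul_of_one_le_of_one_le (one_le_pow₀ hd) (one_le_pow₀ hdH)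
  have hB : (1 : ℝ) ≤ S.l1B m * ((S.d : ℝ) ^ 7 * (S.d * S.H₀) ^ S.nDeg m) :=
    one_le_mul_of_one_le_of_one_le hl hdd
  have hCfB : (1 : ℝ) ≤ (Fintype.card (S.Λ m) : ℝ) * S.A₀ m * (S.l1B m * ((S.d : ℝ) ^ 7 * (S.d * S.H₀) ^ S.nDeg m)) :=
    one_le_mul_of_one_le_of_one_le (one_le_mul_of_one_le_of_one_le hcard hA) hB
  exact one_le_mul_of_one_le_of_one_le (one_le_mul_of_one_le_of_one_le
    (one_le_mul_of_one_le_of_one_le hcard (one_le_mul_of_one_le_of_one_le hA hCfB)) hl) hdd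

/-- `K_δ = d (2C_nδ₀ + 1)`: `deg Q ≤ K_δ m⁶`. [folklore] -/
def Kδ : ℕ := S.d * (2 * S.Cn * S.δ₀ + 1)

/-- The degree bound in the currency `m⁶`. [folklore] -/
lemma deg_le (hm : 1 ≤ m) {Q : ℤ[X]} (hQ : Q.natDegree ≤ S.d * (S.A₀ m + S.nDeg m * S.δ₀)) :
    (Q.natDegree : ℝ) ≤ S.Kδ * (m : ℝ) ^ 6 := by
  have h1 : S.d * (S.A₀ m + S.nDeg m * S.δ₀) ≤ S.Kδ * m ^ 6 := by
    unfold A₀ nDeg Kδ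
    have hm6 : 1 ≤ m ^ 6 := Nat.one_le_pow _ _ hm
    have : S.d * (S.Cn * m ^ 6 * S.δ₀ + 1 + S.Cn * m ^ 6 * S.δ₀) ≤ S.d * ((2 * S.Cn * S.δ₀ + 1) * m ^ 6) := by
      apply Nat.mul_le_mul_left
      nlinarith
    calc _ ≤ S.d * ((2 * S.Cn * S.δ₀ + 1) * m ^ 6) := this
      _ = _ := by ring
  exact_mod_cast hQ.trans h1

/-- `K_σ = K_δ + d² + d κ_H`: `t(Q) ≤ K_σ m⁷`. [folklore] -/
def Kσ : ℝ := S.Kδ + (S.d : ℝ) ^ 2 + S.d * S.κH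

/-- `1 ≤ K_σ`. [folklore] -/
lemma one_le_Kσ : 1 ≤ S.Kσ := by
  unfold Kσ
  have hd : (1 : ℝ) ≤ S.d := by exact_mod_cast S.one_le_d
  have := S.κH_nonneg
  have : (0 : ℝ) ≤ S.Kδ := Nat.cast_nonneg _
  nlinarith

/-- **The type bound**: `t(Q) ≤ K_σ m⁷` for `Q ≠ 0` with the degree and height bounds of
`level_struct` (`m ≥ 1`). [folklore] -/
theorem type_le (hm : 1 ≤ m) {Q : ℤ[X]} (hQ0 : Q ≠ 0)
    (hdeg : Q.natDegree ≤ S.d * (S.A₀ m + S.nDeg m * S.δ₀)) (hzl1 : zl1 Q ≤ ((S.d : ℝ) * S.HY m) ^ S.d) :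
    Q.gelfondType ≤ S.Kσ * (m : ℝ) ^ 7 := by
  have hm1 : (1 : ℝ) ≤ m := by exact_mod_cast hm
  unfold Polynomial.gelfondType
  have hd : (1 : ℝ) ≤ S.d := by exact_mod_cast S.one_le_d
  have hd0 : (0 : ℝ) < S.d := by linarith
  have hdeg' := S.deg_le m hm hdeg
  have hsup1 : 1 ≤ Q.supNorm := Polynomial.one_le_supNorm_of_ne_zero hQ0
  have hHY := S.HY_le_exp m hm
  have hHY1 := S.one_le_HY m hm
  have hlog : Real.log Q.supNorm ≤ S.d * (S.d + S.κH * (m : ℝ) ^ 7) := by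
    have h1 : Real.log Q.supNorm ≤ Real.log (zl1 Q) := Real.log_le_log (by linarith) (supNorm_le_zl1 _)
    have h2 : Real.log (zl1 Q) ≤ Real.log (((S.d : ℝ) * S.HY m) ^ S.d) :=
      Real.log_le_log (by linarith [supNorm_le_zl1 Q]) hzl1
    have h3 : Real.log (((S.d : ℝ) * S.HY m) ^ S.d) = S.d * (Real.log S.d + Real.log (S.HY m)) := by
      rw [Real.log_pow, Real.log_mul hd0.ne' (by linarith)]
    have h4 : Real.log (S.d : ℝ) ≤ S.d := Real.log_le_self hd0.le
    have h5 : Real.log (S.HY m) ≤ S.κH * (m : ℝ) ^ 7 := by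
      have := Real.log_le_log (by linarith) hHY
      rwa [Real.log_exp] at this
    calc Real.log Q.supNorm ≤ S.d * (Real.log S.d + Real.log (S.HY m)) := by linarith
      _ ≤ S.d * (S.d + S.κH * (m : ℝ) ^ 7) := by gcongr
  have h67 : (m : ℝ) ^ 6 ≤ (m : ℝ) ^ 7 := pow_le_pow_right₀ hm1 (by norm_num)
  have h7 : (1 : ℝ) ≤ (m : ℝ) ^ 7 := one_le_pow₀ hm1
  have hKδ : (0 : ℝ) ≤ S.Kδ := Nat.cast_nonneg _
  have hκ := S.κH_nonneg
  unfold Kσ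
  nlinarith [mul_le_mul_of_nonneg_left h67 hKδ, mul_le_mul_of_nonneg_left h7 (by positivity : (0:ℝ) ≤ (S.d:ℝ)^2)]

/-- `Θ^E ≤ exp(E Θ)`... precisely `Θ^e ≤ exp(e Θ)`. [folklore] -/
lemma Θθ_pow_le_exp (e : ℕ) : S.Θθ ^ e ≤ Real.exp (e * S.Θθ) :=
  pow_le_exp_of_log_le (lt_of_lt_of_le one_pos S.one_le_Θθ) e
    (Real.log_le_self (le_trans zero_le_one S.one_le_Θθ))

/-- `C_p ≤ exp(κ_p m⁷)` with `κ_p = κ_A + κ_CfB + κ_A Θ` (`m ≥ 1`). [folklore] -/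
lemma Cp_le_exp (hm : 1 ≤ m) :
    S.Cp m ≤ Real.exp ((S.κA + ((S.Ca + 14) + S.κA + S.κl + (7 * S.d + S.Cn * S.d * S.H₀)) + S.κA * S.Θθ) *
      (m : ℝ) ^ 7) := by
  have hm1 : (1 : ℝ) ≤ m := by exact_mod_cast hm
  unfold Cp
  have h1 := S.A₀_le_exp m hm
  have h2 := S.CfB_le_exp m hm
  have h3 : max 1 ‖S.θ‖ ^ S.A₀ m ≤ Real.exp (S.κA * S.Θθ * (m : ℝ) ^ 7) := by
    refine (S.Θθ_pow_le_exp (S.A₀ m)).trans (Real.exp_le_exp.mpr ?_)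
    have hA := S.A₀_le m hm
    have h67 : (m : ℝ) ^ 6 ≤ (m : ℝ) ^ 7 := pow_le_pow_right₀ hm1 (by norm_num)
    have hΘ : (0 : ℝ) ≤ S.Θθ := le_trans zero_le_one S.one_le_Θθ
    have hκA : (0 : ℝ) ≤ S.κA := le_trans zero_le_one S.one_le_κA
    calc (S.A₀ m : ℝ) * S.Θθ ≤ S.κA * (m : ℝ) ^ 6 * S.Θθ := mul_le_mul_of_nonneg_right hA hΘ
      _ ≤ S.κA * (m : ℝ) ^ 7 * S.Θθ := by gcongr
      _ = _ := by ring
  have hCfB0 : 0 ≤ S.CfB m := by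
    unfold CfB Bsieg
    have hl0 : 0 ≤ S.l1B m := le_trans zero_le_one (S.one_le_l1B m hm)
    have := S.H₀_nonneg
    positivity
  calc (S.A₀ m : ℝ) * S.CfB m * max 1 ‖S.θ‖ ^ S.A₀ m
      ≤ Real.exp (S.κA * (m : ℝ) ^ 7) *
        Real.exp (((S.Ca + 14) + S.κA + S.κl + (7 * S.d + S.Cn * S.d * S.H₀)) * (m : ℝ) ^ 7) *
          Real.exp (S.κA * S.Θθ * (m : ℝ) ^ 7) := by gcongr
    _ = _ := by rw [← Real.exp_add, ← Real.exp_add]; ring_nf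

/-- `K_v`: `log |Q(θ)| ≤ K_v m¹³ - K₂ m¹⁴`. [folklore] -/
def Kv : ℝ :=
  S.Cn * max 1 ‖Polynomial.aeval S.θ S.E.b‖ +
  ((S.κA + ((S.Ca + 14) + S.κA + S.κl + (7 * S.d + S.Cn * S.d * S.H₀)) + S.κA * S.Θθ) +
    (S.Ca + 14) + (S.K₁ : ℝ) ^ 2 + S.CF * (S.K₁ + S.Ca * S.K2 + S.K2)) +
  S.d * (2 * S.d + 1 + S.κH + (2 * S.Cn * S.δ₀ + 1) * S.Θθ)

/-- `jetB m C_p ≤ exp(κ_j m¹³) exp(-K₂ m¹⁴)` (`m ≥ 1`). [folklore] -/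
lemma jetB_le_exp (hm : 1 ≤ m) :
    S.jetB m (S.Cp m) ≤
      Real.exp (((S.κA + ((S.Ca + 14) + S.κA + S.κl + (7 * S.d + S.Cn * S.d * S.H₀)) + S.κA * S.Θθ) +
        (S.Ca + 14) + (S.K₁ : ℝ) ^ 2 + S.CF * (S.K₁ + S.Ca * S.K2 + S.K2)) * (m : ℝ) ^ 13) *
      Real.exp (-((S.K2 : ℝ) * (m : ℝ) ^ 14)) := by
  have hm1 : (1 : ℝ) ≤ m := by exact_mod_cast hm
  have h713 : (m : ℝ) ^ 7 ≤ (m : ℝ) ^ 13 := pow_le_pow_right₀ hm1 (by norm_num)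
  have hCF := S.CF_nonneg
  unfold jetB
  refine mul_le_mul_of_nonneg_right ?_ (by positivity)
  -- the four factors
  have h1 : S.Cp m ≤ Real.exp ((S.κA + ((S.Ca + 14) + S.κA + S.κl + (7 * S.d + S.Cn * S.d * S.H₀)) +
      S.κA * S.Θθ) * (m : ℝ) ^ 13) := by
    refine (S.Cp_le_exp m hm).trans (Real.exp_le_exp.mpr (mul_le_mul_of_nonneg_left h713 ?_))
    have := S.one_le_κA; have := S.κl_nonneg; have := S.H₀_nonneg
    have : (0:ℝ) ≤ S.Θθ := le_trans zero_le_one S.one_le_Θθ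
    positivity
  have h2 : (Fintype.card (S.Λ m) : ℝ) ≤ Real.exp ((S.Ca + 14) * (m : ℝ) ^ 13) :=
    (S.card_le_exp m hm).trans (Real.exp_le_exp.mpr (mul_le_mul_of_nonneg_left h713 (by positivity)))
  have h3 : (((S.T m)! : ℕ) : ℝ) ≤ Real.exp ((S.K₁ : ℝ) ^ 2 * (m : ℝ) ^ 13) := by
    refine (factorial_le_exp_sq (S.T m)).trans (Real.exp_le_exp.mpr ?_)
    have hT : ((S.T m : ℕ) : ℝ) = S.K₁ * (m : ℝ) ^ 6 := by unfold T; push_cast; ring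
    rw [hT]
    have h1213 : (m : ℝ) ^ 12 ≤ (m : ℝ) ^ 13 := pow_le_pow_right₀ hm1 (by norm_num)
    have hK : (0 : ℝ) ≤ (S.K₁ : ℝ) ^ 2 := by positivity
    calc (S.K₁ * (m : ℝ) ^ 6) ^ 2 = (S.K₁ : ℝ) ^ 2 * (m : ℝ) ^ 12 := by ring
      _ ≤ (S.K₁ : ℝ) ^ 2 * (m : ℝ) ^ 13 := mul_le_mul_of_nonneg_left h1213 hK
  have h4 : Real.exp (S.CF * (S.T m + S.La m * (S.K2 * m ^ 4) + L0 m * (S.K2 * m ^ 4))) ≤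
      Real.exp (S.CF * (S.K₁ + S.Ca * S.K2 + S.K2) * (m : ℝ) ^ 13) := by
    refine Real.exp_le_exp.mpr ?_
    have hT : ((S.T m : ℕ) : ℝ) = S.K₁ * (m : ℝ) ^ 6 := by unfold T; push_cast; ring
    have hLa : ((S.La m : ℕ) : ℝ) = S.Ca * (m : ℝ) ^ 6 := by unfold La; push_cast; ring
    have hL0 : ((L0 m : ℕ) : ℝ) = (m : ℝ) ^ 2 := by unfold L0; push_cast; ring
    rw [hT, hLa, hL0]
    have h613 : (m : ℝ) ^ 6 ≤ (m : ℝ) ^ 13 := pow_le_pow_right₀ hm1 (by norm_num)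
    have h1013 : (m : ℝ) ^ 10 ≤ (m : ℝ) ^ 13 := pow_le_pow_right₀ hm1 (by norm_num)
    have e1 : S.K₁ * (m : ℝ) ^ 6 + S.Ca * (m : ℝ) ^ 6 * (S.K2 * (m : ℝ) ^ 4) + (m : ℝ) ^ 2 * (S.K2 * (m : ℝ) ^ 4) =
        S.K₁ * (m : ℝ) ^ 6 + S.Ca * S.K2 * (m : ℝ) ^ 10 + S.K2 * (m : ℝ) ^ 6 := by ring
    rw [e1]
    have hK₁ : (0:ℝ) ≤ S.K₁ := Nat.cast_nonneg _
    have hK2 : (0:ℝ) ≤ S.K2 := Nat.cast_nonneg _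
    have hCaK : (0:ℝ) ≤ S.Ca * S.K2 := by positivity
    have key : S.K₁ * (m : ℝ) ^ 6 + S.Ca * S.K2 * (m : ℝ) ^ 10 + S.K2 * (m : ℝ) ^ 6 ≤
        (S.K₁ + S.Ca * S.K2 + S.K2) * (m : ℝ) ^ 13 := by
      nlinarith [mul_le_mul_of_nonneg_left h613 hK₁, mul_le_mul_of_nonneg_left h1013 hCaK,
        mul_le_mul_of_nonneg_left h613 hK2]
    calc S.CF * (S.K₁ * (m : ℝ) ^ 6 + S.Ca * S.K2 * (m : ℝ) ^ 10 + S.K2 * (m : ℝ) ^ 6)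
        ≤ S.CF * ((S.K₁ + S.Ca * S.K2 + S.K2) * (m : ℝ) ^ 13) := mul_le_mul_of_nonneg_left key hCF
      _ = _ := by ring
  have hCp0 : 0 ≤ S.Cp m := by unfold Cp; have := S.one_le_l1B m hm; unfold CfB Bsieg; have := S.H₀_nonneg; positivity
  calc S.Cp m * Fintype.card (S.Λ m) * ((S.T m)! : ℝ) *
        Real.exp (S.CF * (S.T m + S.La m * (S.K2 * m ^ 4) + L0 m * (S.K2 * m ^ 4)))
      ≤ Real.exp ((S.κA + ((S.Ca + 14) + S.κA + S.κl + (7 * S.d + S.Cn * S.d * S.H₀)) + S.κA * S.Θθ) * (m : ℝ) ^ 13) *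
        Real.exp ((S.Ca + 14) * (m : ℝ) ^ 13) * Real.exp ((S.K₁ : ℝ) ^ 2 * (m : ℝ) ^ 13) *
        Real.exp (S.CF * (S.K₁ + S.Ca * S.K2 + S.K2) * (m : ℝ) ^ 13) := by
        gcongr
    _ = _ := by rw [← Real.exp_add, ← Real.exp_add, ← Real.exp_add]; ring_nf

/-- **The value bound**: `valB ≤ exp(K_v m¹³ - K₂ m¹⁴)` (`m ≥ 1`). [folklore] -/
theorem valB_le_exp (hm : 1 ≤ m) :
    S.valB m ≤ Real.exp (S.Kv * (m : ℝ) ^ 13 - S.K2 * (m : ℝ) ^ 14) := by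
  have hm1 : (1 : ℝ) ≤ m := by exact_mod_cast hm
  have h613 : (m : ℝ) ^ 6 ≤ (m : ℝ) ^ 13 := pow_le_pow_right₀ hm1 (by norm_num)
  have h713 : (m : ℝ) ^ 7 ≤ (m : ℝ) ^ 13 := pow_le_pow_right₀ hm1 (by norm_num)
  have h13 : (1 : ℝ) ≤ (m : ℝ) ^ 13 := one_le_pow₀ hm1
  have hd : (1 : ℝ) ≤ S.d := by exact_mod_cast S.one_le_d
  have hd0 : (0 : ℝ) < S.d := by linarith
  unfold valB
  -- factor 1: `|b(θ)|^n`
  set Θb : ℝ := max 1 ‖Polynomial.aeval S.θ S.E.b‖ with hΘb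
  have hΘb1 : 1 ≤ Θb := le_max_left _ _
  have f1 : ‖Polynomial.aeval S.θ S.E.b‖ ^ S.nDeg m ≤ Real.exp (S.Cn * Θb * (m : ℝ) ^ 13) := by
    calc ‖Polynomial.aeval S.θ S.E.b‖ ^ S.nDeg m ≤ Θb ^ S.nDeg m :=
          pow_le_pow_left₀ (norm_nonneg _) (le_max_right _ _) _
      _ ≤ Real.exp (S.nDeg m * Θb) :=
          pow_le_exp_of_log_le (by linarith) _ (Real.log_le_self (by linarith))
      _ ≤ Real.exp (S.Cn * Θb * (m : ℝ) ^ 13) := by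
          refine Real.exp_le_exp.mpr ?_
          have hn : ((S.nDeg m : ℕ) : ℝ) = S.Cn * (m : ℝ) ^ 6 := by unfold nDeg; push_cast; ring
          rw [hn]
          have : (0:ℝ) ≤ S.Cn * Θb := by positivity
          nlinarith [mul_le_mul_of_nonneg_left h613 this]
  -- factor 2: `jetB`
  have f2 := S.jetB_le_exp m hm
  -- factor 3: the cofactor bound
  have hHY := S.HY_le_exp m hm
  have hHY1 := S.one_le_HY m hm
  set Eexp : ℕ := S.A₀ m + S.nDeg m * S.δ₀ with hE
  have hEle : (Eexp : ℝ) ≤ (2 * S.Cn * S.δ₀ + 1) * (m : ℝ) ^ 6 := by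
    have : Eexp ≤ (2 * S.Cn * S.δ₀ + 1) * m ^ 6 := by
      rw [hE]; unfold A₀ nDeg; nlinarith [Nat.one_le_pow 6 m hm]
    exact_mod_cast this
  have f3 : S.d * (1 + S.d * (S.HY m * max 1 ‖S.θ‖ ^ Eexp)) ^ S.d ≤
      Real.exp (S.d * (2 * S.d + 1 + S.κH + (2 * S.Cn * S.δ₀ + 1) * S.Θθ) * (m : ℝ) ^ 13) := by
    have hΘ := S.one_le_Θθ
    have hΘE : 1 ≤ S.Θθ ^ Eexp := one_le_pow₀ hΘ
    have hbig : 1 ≤ S.d * (S.HY m * S.Θθ ^ Eexp) :=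
      one_le_mul_of_one_le_of_one_le hd (one_le_mul_of_one_le_of_one_le hHY1 hΘE)
    have hinner : 1 + S.d * (S.HY m * max 1 ‖S.θ‖ ^ Eexp) ≤ 2 * (S.d * (S.HY m * S.Θθ ^ Eexp)) := by
      change 1 + S.d * (S.HY m * S.Θθ ^ Eexp) ≤ _; linarith
    have hbase_pos : 0 < 1 + S.d * (S.HY m * max 1 ‖S.θ‖ ^ Eexp) := by
      change 0 < 1 + S.d * (S.HY m * S.Θθ ^ Eexp); positivity
    -- log of the base
    have hlogbase : Real.log (1 + S.d * (S.HY m * max 1 ‖S.θ‖ ^ Eexp)) ≤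
        1 + S.d + S.κH * (m : ℝ) ^ 7 + (2 * S.Cn * S.δ₀ + 1) * (m : ℝ) ^ 6 * S.Θθ := by
      have hpos2 : 0 < 2 * (S.d * (S.HY m * S.Θθ ^ Eexp)) := by positivity
      have h1 : Real.log (1 + S.d * (S.HY m * max 1 ‖S.θ‖ ^ Eexp)) ≤
          Real.log (2 * (S.d * (S.HY m * S.Θθ ^ Eexp))) := Real.log_le_log hbase_pos hinner
      have h2 : Real.log (2 * (S.d * (S.HY m * S.Θθ ^ Eexp))) =
          Real.log 2 + Real.log S.d + Real.log (S.HY m) + Eexp * Real.log S.Θθ := by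
        rw [Real.log_mul (by norm_num) (by positivity), Real.log_mul hd0.ne' (by positivity),
          Real.log_mul (by linarith) (by positivity), Real.log_pow]
        ring
      have h3 : Real.log (S.d : ℝ) ≤ S.d := Real.log_le_self hd0.le
      have h4 : Real.log 2 ≤ (1 : ℝ) := by
        have := Real.log_two_lt_d9; linarith
      have h5 : Real.log (S.HY m) ≤ S.κH * (m : ℝ) ^ 7 := by
        have := Real.log_le_log (by linarith) hHY
        rwa [Real.log_exp] at this
      have h6 : Real.log S.Θθ ≤ S.Θθ := Real.log_le_self (by linarith)
      have h7 : (Eexp : ℝ) * Real.log S.Θθ ≤ (2 * S.Cn * S.δ₀ + 1) * (m : ℝ) ^ 6 * S.Θθ := by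
        have hl0 : 0 ≤ Real.log S.Θθ := Real.log_nonneg hΘ
        calc (Eexp : ℝ) * Real.log S.Θθ ≤ (2 * S.Cn * S.δ₀ + 1) * (m : ℝ) ^ 6 * Real.log S.Θθ :=
              mul_le_mul_of_nonneg_right hEle hl0
          _ ≤ _ := mul_le_mul_of_nonneg_left h6 (by positivity)
      linarith
    have hpow : (1 + S.d * (S.HY m * max 1 ‖S.θ‖ ^ Eexp)) ^ S.d ≤
        Real.exp (S.d * (1 + S.d + S.κH * (m : ℝ) ^ 7 + (2 * S.Cn * S.δ₀ + 1) * (m : ℝ) ^ 6 * S.Θθ)) :=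
      pow_le_exp_of_log_le hbase_pos S.d hlogbase
    have hdexp : (S.d : ℝ) ≤ Real.exp S.d := by linarith [Real.add_one_le_exp (S.d : ℝ)]
    have hκ := S.κH_nonneg
    have hq : (0:ℝ) ≤ (2 * S.Cn * S.δ₀ + 1) * S.Θθ := by
      have : (0:ℝ) ≤ S.Θθ := by linarith
      positivity
    calc S.d * (1 + S.d * (S.HY m * max 1 ‖S.θ‖ ^ Eexp)) ^ S.d
        ≤ Real.exp S.d * Real.exp (S.d * (1 + S.d + S.κH * (m : ℝ) ^ 7 + (2 * S.Cn * S.δ₀ + 1) * (m : ℝ) ^ 6 * S.Θθ)) :=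
          mul_le_mul hdexp hpow (by positivity) (by positivity)
      _ = Real.exp (S.d + S.d * (1 + S.d + S.κH * (m : ℝ) ^ 7 + (2 * S.Cn * S.δ₀ + 1) * (m : ℝ) ^ 6 * S.Θθ)) := by
          rw [← Real.exp_add]
      _ ≤ Real.exp (S.d * (2 * S.d + 1 + S.κH + (2 * S.Cn * S.δ₀ + 1) * S.Θθ) * (m : ℝ) ^ 13) := by
          refine Real.exp_le_exp.mpr ?_
          have hd' : (0:ℝ) ≤ S.d := hd0.le
          set q : ℝ := (2 * S.Cn * S.δ₀ + 1) * S.Θθ with hqdef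
          set M : ℝ := (m : ℝ) ^ 13 with hM
          have e1 : (S.d : ℝ) + S.d * (1 + S.d + S.κH * (m : ℝ) ^ 7 + (2 * S.Cn * S.δ₀ + 1) * (m : ℝ) ^ 6 * S.Θθ) =
              S.d * (2 + S.d) * 1 + S.d * S.κH * (m : ℝ) ^ 7 + S.d * q * (m : ℝ) ^ 6 := by rw [hqdef]; ring
          rw [e1]
          have t1 : S.d * (2 + S.d) * 1 ≤ S.d * (2 + S.d) * M :=
            mul_le_mul_of_nonneg_left h13 (by positivity)
          have t2 : S.d * S.κH * (m : ℝ) ^ 7 ≤ S.d * S.κH * M :=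
            mul_le_mul_of_nonneg_left h713 (mul_nonneg hd' hκ)
          have t3 : S.d * q * (m : ℝ) ^ 6 ≤ S.d * q * M :=
            mul_le_mul_of_nonneg_left h613 (mul_nonneg hd' hq)
          have t4 : S.d * (2 + S.d) * M + S.d * S.κH * M + S.d * q * M = S.d * (2 + S.d + S.κH + q) * M := by ring
          have t5 : S.d * (2 + S.d + S.κH + q) * M ≤ S.d * (2 * S.d + 1 + S.κH + q) * M := by
            have hM0 : 0 ≤ M := by rw [hM]; positivity
            have : (2 : ℝ) + S.d ≤ 2 * S.d + 1 := by linarith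
            have : S.d * (2 + S.d + S.κH + q) ≤ S.d * (2 * S.d + 1 + S.κH + q) :=
              mul_le_mul_of_nonneg_left (by linarith) hd'
            exact mul_le_mul_of_nonneg_right this hM0
          linarith
  calc ‖Polynomial.aeval S.θ S.E.b‖ ^ S.nDeg m * S.jetB m (S.Cp m) *
        (S.d * (1 + S.d * (S.HY m * max 1 ‖S.θ‖ ^ Eexp)) ^ S.d)
      ≤ Real.exp (S.Cn * Θb * (m : ℝ) ^ 13) *
        (Real.exp (((S.κA + ((S.Ca + 14) + S.κA + S.κl + (7 * S.d + S.Cn * S.d * S.H₀)) + S.κA * S.Θθ) +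
          (S.Ca + 14) + (S.K₁ : ℝ) ^ 2 + S.CF * (S.K₁ + S.Ca * S.K2 + S.K2)) * (m : ℝ) ^ 13) *
          Real.exp (-((S.K2 : ℝ) * (m : ℝ) ^ 14))) *
        Real.exp (S.d * (2 * S.d + 1 + S.κH + (2 * S.Cn * S.δ₀ + 1) * S.Θθ) * (m : ℝ) ^ 13) := by
        have hj0 : 0 ≤ S.jetB m (S.Cp m) := S.jetB_nonneg m (by unfold Cp; have := S.one_le_l1B m hm; unfold CfB Bsieg; have := S.H₀_nonneg; positivity)
        gcongr
    _ = Real.exp (S.Kv * (m : ℝ) ^ 13 - S.K2 * (m : ℝ) ^ 14) := by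
        rw [← Real.exp_add, ← Real.exp_add, ← Real.exp_add]
        unfold Kv
        rw [hΘb]
        ring_nf

/-- **The three bounds at level `m`** (`m ≥ 1`, `m ≥ m₁`): `Q(θ) ≠ 0`, `deg Q ≤ K_δ m⁶`,
`t(Q) ≤ K_σ m⁷`, `|Q(θ)| ≤ exp(K_v m¹³ - K₂ m¹⁴)`. [cite: Chudnovsky1984, Ch. 7 Thm 4.1 p. 318] -/
theorem level (hm : 1 ≤ m) (hm₁ : S.m₁ ≤ m) :
    ∃ Q : ℤ[X], Polynomial.aeval S.θ Q ≠ 0 ∧ (Q.natDegree : ℝ) ≤ S.Kδ * (m : ℝ) ^ 6 ∧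
      Q.gelfondType ≤ S.Kσ * (m : ℝ) ^ 7 ∧
      ‖Polynomial.aeval S.θ Q‖ ≤ Real.exp (S.Kv * (m : ℝ) ^ 13 - S.K2 * (m : ℝ) ^ 14) := by
  obtain ⟨Q, hQθ, hdeg, hzl1, hval⟩ := S.level_struct m hm hm₁
  have hQ0 : Q ≠ 0 := fun h => hQθ (by rw [h, map_zero])
  exact ⟨Q, hQθ, S.deg_le m hm hdeg, S.type_le m hm hQ0 hdeg hzl1, hval.trans (S.valB_le_exp m hm)⟩

end LevelBounds

/-! ### §2 Gel'fond's criterion: the core contradiction -/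

/-- `(s+1)^k ≤ 2^k s^k` for `s ≥ 1`. [folklore] -/
lemma succ_pow_le {s : ℝ} (hs : 1 ≤ s) (k : ℕ) : (s + 1) ^ k ≤ 2 ^ k * s ^ k := by
  rw [← mul_pow]
  exact pow_le_pow_left₀ (by linarith) (by linarith) k

/-- The starting level `m₀`. [folklore] -/
def m₀ : ℕ := S.m₁ + 1 + ⌈(S.Kv + 10240 * (S.Kδ + 1) * (S.Kσ + 1)) / S.K2⌉₊

/-- **The core contradiction** (Chudnovsky 1984, Ch. 7, p. 318: "In other words deg tr `K = 1`
is impossible"): a `Setup` cannot exist. [cite: Chudnovsky1984, Ch. 7 Thm 4.1 p. 318] -/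
theorem core (S : Setup) : False := by
  classical
  -- the level function
  set sOf : ℕ → ℕ := fun N => N + S.m₀ with hsOf
  have hm₀1 : 1 ≤ S.m₀ := by unfold m₀; omega
  have hsOf1 : ∀ N, 1 ≤ sOf N := fun N => by simp only [hsOf]; omega
  have hsOfm₁ : ∀ N, S.m₁ ≤ sOf N := fun N => by simp only [hsOf]; unfold m₀; omega
  have hsR : ∀ N, (1 : ℝ) ≤ (sOf N : ℝ) := fun N => by exact_mod_cast hsOf1 N
  have hlev : ∀ N, ∃ Q : ℤ[X], Polynomial.aeval S.θ Q ≠ 0 ∧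
      (Q.natDegree : ℝ) ≤ S.Kδ * (sOf N : ℝ) ^ 6 ∧ Q.gelfondType ≤ S.Kσ * (sOf N : ℝ) ^ 7 ∧
      ‖Polynomial.aeval S.θ Q‖ ≤ Real.exp (S.Kv * (sOf N : ℝ) ^ 13 - S.K2 * (sOf N : ℝ) ^ 14) :=
    fun N => S.level (sOf N) (hsOf1 N) (hsOfm₁ N)
  choose Pseq hP using hlev
  -- the sequences
  have hKδ0 : (0 : ℝ) ≤ S.Kδ := Nat.cast_nonneg _
  have hKσ1 := S.one_le_Kσ
  let δ : ℕ → ℝ := fun N => (S.Kδ + 1) * (sOf N : ℝ) ^ 6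
  let σ : ℕ → ℝ := fun N => (S.Kσ + 1) * (sOf N : ℝ) ^ 7
  have hsmono : ∀ {a b : ℕ}, a ≤ b → (sOf a : ℝ) ≤ sOf b := fun h => by
    simp only [hsOf]; exact_mod_cast Nat.add_le_add_right h _
  have hδm : Monotone δ := fun a b h =>
    mul_le_mul_of_nonneg_left (pow_le_pow_left₀ (by linarith [hsR a]) (hsmono h) 6) (by positivity)
  have hσm : Monotone σ := fun a b h =>
    mul_le_mul_of_nonneg_left (pow_le_pow_left₀ (by linarith [hsR a]) (hsmono h) 7) (by positivity)
  have hδ0 : ∀ N, 0 < δ N := fun N => by have := hsR N; positivity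
  have hσ0 : ∀ N, 0 < σ N := fun N => by have := hsR N; positivity
  have hσge : ∀ N : ℕ, (N : ℝ) ≤ σ N := fun N => by
    have h1 : (N : ℝ) ≤ sOf N := by simp only [hsOf]; push_cast; linarith
    have h2 : (sOf N : ℝ) ≤ (sOf N : ℝ) ^ 7 := by
      calc (sOf N : ℝ) = (sOf N : ℝ) ^ 1 := (pow_one _).symm
        _ ≤ _ := pow_le_pow_right₀ (hsR N) (by norm_num)
    have h3 : (sOf N : ℝ) ^ 7 ≤ (S.Kσ + 1) * (sOf N : ℝ) ^ 7 :=
      le_mul_of_one_le_left (by positivity) (by linarith)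
    linarith
  have hσ : Tendsto σ atTop atTop := tendsto_atTop_mono hσge tendsto_natCast_atTop_atTop
  have hs1 : ∀ N, (sOf (N + 1) : ℝ) = sOf N + 1 := fun N => by simp only [hsOf]; push_cast; ring
  have hδa : ∀ N, δ (N + 1) ≤ 256 * δ N := fun N => by
    show (S.Kδ + 1) * (sOf (N + 1) : ℝ) ^ 6 ≤ 256 * ((S.Kδ + 1) * (sOf N : ℝ) ^ 6)
    rw [hs1]
    have := succ_pow_le (hsR N) 6
    have h0 : (0:ℝ) ≤ (sOf N : ℝ) ^ 6 := by positivity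
    norm_num at this
    nlinarith
  have hσa : ∀ N, σ (N + 1) < 256 * σ N := fun N => by
    show (S.Kσ + 1) * (sOf (N + 1) : ℝ) ^ 7 < 256 * ((S.Kσ + 1) * (sOf N : ℝ) ^ 7)
    rw [hs1]
    have := succ_pow_le (hsR N) 7
    have h0 : (0:ℝ) < (sOf N : ℝ) ^ 7 := by have := hsR N; positivity
    norm_num at this
    nlinarith
  -- the three conditions at each level
  have hPN : ∀ N, 0 ≤ N → Pseq N ≠ 0 ∧ ((Pseq N).natDegree : ℝ) < δ N ∧ (Pseq N).gelfondType < σ N := by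
    intro N _
    obtain ⟨hQθ, hQdeg, hQt, -⟩ := hP N
    have hQ0 : Pseq N ≠ 0 := fun h => hQθ (by rw [h, map_zero])
    have h6 : (0:ℝ) < (sOf N : ℝ) ^ 6 := by have := hsR N; positivity
    have h7 : (0:ℝ) < (sOf N : ℝ) ^ 7 := by have := hsR N; positivity
    refine ⟨hQ0, ?_, ?_⟩
    · show ((Pseq N).natDegree : ℝ) < (S.Kδ + 1) * (sOf N : ℝ) ^ 6
      nlinarith
    · show (Pseq N).gelfondType < (S.Kσ + 1) * (sOf N : ℝ) ^ 7
      nlinarith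
  obtain ⟨N, -, hle⟩ := Literature.NumberTheory.Transcendental.gelfond_criterion_not_small_values
    S.hθ 256 (by norm_num) δ σ hδm hσm hδ0 hσ0 hσ hδa hσa Pseq 0 hPN
  -- but `|P_N(θ)| ≤ exp(K_v s¹³ - K₂ s¹⁴) < exp(-40·256 δ σ)`
  obtain ⟨-, -, -, hQval⟩ := hP N
  set s : ℝ := (sOf N : ℝ) with hsdef
  have hs1' : 1 ≤ s := hsR N
  have hK2 : (1 : ℝ) ≤ S.K2 := by exact_mod_cast S.one_le_K2
  have hK2pos : (0 : ℝ) < S.K2 := by linarith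
  -- `s ≥ m₀ > (K_v + 5120 (Kδ+1)(Kσ+1))/K₂`
  have hsbig : (S.Kv + 10240 * (S.Kδ + 1) * (S.Kσ + 1)) / S.K2 + 1 ≤ s := by
    have h1 : (S.m₀ : ℝ) ≤ s := by rw [hsdef]; simp only [hsOf]; push_cast; linarith
    have h2 : (⌈(S.Kv + 10240 * (S.Kδ + 1) * (S.Kσ + 1)) / S.K2⌉₊ : ℝ) + 1 ≤ S.m₀ := by
      unfold m₀; push_cast; linarith
    linarith [Nat.le_ceil ((S.Kv + 10240 * (S.Kδ + 1) * (S.Kσ + 1)) / S.K2)]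
  have hgap : S.Kv * s ^ 13 - S.K2 * s ^ 14 < -40 * 256 * δ N * σ N := by
    show S.Kv * s ^ 13 - S.K2 * s ^ 14 < -40 * 256 * ((S.Kδ + 1) * s ^ 6) * ((S.Kσ + 1) * s ^ 7)
    have e1 : -40 * 256 * ((S.Kδ + 1) * s ^ 6) * ((S.Kσ + 1) * s ^ 7) =
        -(10240 * (S.Kδ + 1) * (S.Kσ + 1)) * s ^ 13 := by ring
    rw [e1]
    have h13 : 0 < s ^ 13 := by positivity
    -- `(K_v + 10240(Kδ+1)(Kσ+1)) < K₂ s`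
    have hlt : S.Kv + 10240 * (S.Kδ + 1) * (S.Kσ + 1) < S.K2 * s := by
      have := (div_le_iff₀ hK2pos).mp (show (S.Kv + 10240 * (S.Kδ + 1) * (S.Kσ + 1)) / S.K2 ≤ s - 1 by linarith)
      nlinarith
    have : S.K2 * s ^ 14 = (S.K2 * s) * s ^ 13 := by ring
    rw [this]
    nlinarith
  have hpos : 0 < ‖Polynomial.aeval S.θ (Pseq N)‖ := norm_pos_iff.mpr (hP N).1
  have hexp : Real.exp (S.Kv * s ^ 13 - S.K2 * s ^ 14) < Real.exp (-40 * 256 * δ N * σ N) :=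
    Real.exp_lt_exp.mpr hgap
  exact absurd (lt_of_le_of_lt (hle.trans hQval) hexp) (lt_irrefl _)

end Setup

/-! ### §3 From the `θ`-form to a `Setup`; the theorem -/

/-- `e₁ = ℘(ω₁/2)` is algebraic over `ℚ(θ)` as soon as `g₂, g₃` are (it is a root of
`4X³ - g₂X - g₃`). [folklore] -/
theorem isAlgebraic_e₁ (θ : ℂ) (L : PeriodPair) (h₂ : IsAlgebraic ℚ⟮θ⟯ L.g₂)
    (h₃ : IsAlgebraic ℚ⟮θ⟯ L.g₃) : IsAlgebraic ℚ⟮θ⟯ (e₁ L) := by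
  set K₀ : IntermediateField ℚ ℂ := ℚ⟮θ⟯ with hK₀
  let F : IntermediateField K₀ ℂ := IntermediateField.adjoin K₀ {L.g₂, L.g₃}
  haveI hfin : FiniteDimensional K₀ F :=
    IntermediateField.finiteDimensional_adjoin fun y hy => by
      simp only [Set.mem_insert_iff, Set.mem_singleton_iff] at hy
      rcases hy with rfl | rfl
      · exact h₂.isIntegral
      · exact h₃.isIntegral
  haveI : Algebra.IsAlgebraic K₀ F := Algebra.IsAlgebraic.of_finite K₀ F
  have hg₂ : L.g₂ ∈ F := IntermediateField.subset_adjoin K₀ _ (by simp)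
  have hg₃ : L.g₃ ∈ F := IntermediateField.subset_adjoin K₀ _ (by simp)
  -- the cubic over `F`
  set p : Polynomial F := 4 * Polynomial.X ^ 3 - Polynomial.C (⟨L.g₂, hg₂⟩ : F) * Polynomial.X -
    Polynomial.C (⟨L.g₃, hg₃⟩ : F) with hp
  have hp0 : p ≠ 0 := by
    intro h0
    have := congrArg (fun q : Polynomial F => q.coeff 3) h0
    simp [hp] at this
  have heval : Polynomial.aeval (e₁ L) p = 0 := by
    simp only [hp, map_sub, map_mul, Polynomial.aeval_X, Polynomial.aeval_C, map_pow]
    have h4 : Polynomial.aeval (e₁ L) (4 : Polynomial F) = (4 : ℂ) := by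
      rw [show (4 : Polynomial F) = Polynomial.C 4 from rfl, Polynomial.aeval_C, map_ofNat]
    rw [h4]
    change 4 * e₁ L ^ 3 - L.g₂ * e₁ L - L.g₃ = 0
    exact e₁_cubic L
  have halgF : IsAlgebraic F (e₁ L) := ⟨p, hp0, heval⟩
  exact IsAlgebraic.restrictScalars K₀ halgF

/-- **The `θ`-form contradicts the `Setup` machinery**: for no transcendental `θ`, lattice basis
and `c ≠ 0` are all of `g₂, g₃, ω₁, ω₂, c, e^{cω₁}, e^{cω₂}` algebraic over `ℚ(θ)`.
[cite: Chudnovsky1984, Ch. 7 Thm 4.1 p. 318] -/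
theorem thetaForm (θ : ℂ) (hθ : Transcendental ℚ θ) (L : PeriodPair) (c : ℂ) (hc : c ≠ 0)
    (hall : ∀ s ∈ ({L.g₂, L.g₃, L.ω₁, L.ω₂, c, Complex.exp (c * L.ω₁), Complex.exp (c * L.ω₂)} :
      Set ℂ), IsAlgebraic ℚ⟮θ⟯ s) : False := by
  have h₂ : IsAlgebraic ℚ⟮θ⟯ L.g₂ := hall _ (by simp)
  have h₃ : IsAlgebraic ℚ⟮θ⟯ L.g₃ := hall _ (by simp)
  have hω₁ : IsAlgebraic ℚ⟮θ⟯ L.ω₁ := hall _ (by simp)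
  have hω₂ : IsAlgebraic ℚ⟮θ⟯ L.ω₂ := hall _ (by simp)
  have hc' : IsAlgebraic ℚ⟮θ⟯ c := hall _ (by simp)
  have hE₁ : IsAlgebraic ℚ⟮θ⟯ (Complex.exp (c * L.ω₁)) := hall _ (by simp)
  have hE₂ : IsAlgebraic ℚ⟮θ⟯ (Complex.exp (c * L.ω₂)) := hall _ (by simp)
  have he₁ : IsAlgebraic ℚ⟮θ⟯ (e₁ L) := isAlgebraic_e₁ θ L h₂ h₃
  have hhalf : IsAlgebraic ℚ⟮θ⟯ (L.g₂ / 2) := by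
    rw [div_eq_mul_inv]
    refine h₂.mul ?_
    have : algebraMap ℚ⟮θ⟯ ℂ (2⁻¹ : ℚ⟮θ⟯) = (2 : ℂ)⁻¹ := by rw [map_inv₀, map_ofNat]
    rw [← this]
    exact isAlgebraic_algebraMap _
  have hx : ∀ l, IsAlgebraic ℚ⟮θ⟯ (xv L c l) := by
    intro l
    fin_cases l
    · exact hω₁
    · exact hω₂
    · exact hc'
    · exact hE₁
    · exact hE₂
    · exact he₁
    · exact hhalf
  obtain ⟨E⟩ := exists_envelope θ (xv L c) hx
  exact Setup.core ⟨L, c, hc, θ, hθ, E⟩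

/-- **Tubbs 1990, Theorem 4 (periods form) = Chudnovsky 1984, Ch. 7, Theorem 4.1 (i) — PROVED.**
For every lattice basis `(ω₁, ω₂)` of `ℂ` and every `c ≠ 0`,
`trdeg_ℚ ℚ(g₂, g₃, ω₁, ω₂, c, e^{cω₁}, e^{cω₂}) ≥ 2`. Discharge of the named fact
`Literature.NumberTheory.Transcendental.Tubbs1990_thm4_periods`: Gel'fond's method with
Chudnovsky's auxiliary function `P(z, ℘(z), e^{cz})` at the points `ω₁/2 + n₁ω₁ + n₂ω₂`, the
zero estimate replaced by extrapolation plus Tijdeman's lemma, and Gel'fond's criterion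
(tree files `TubbsPeriods*.lean`). [cite: Tubbs1990, Thm 4 p. 112 and Remark p. 114]
[cite: Chudnovsky1984, Ch. 7 Thm 4.1 (i) p. 318] -/
theorem Tubbs1990_thm4_periods_holds : Tubbs1990_thm4_periods :=
  Tubbs1990_thm4_periods_of_thetaForm fun θ hθ L c hc hall => thetaForm θ hθ L c hc hall

end Literature.NumberTheory.Transcendental.TubbsPeriods

/-- Alias in the fact's own namespace: `Tubbs1990_thm4_periods` holds.
[cite: Tubbs1990, Thm 4 p. 112 and Remark p. 114] -/
theorem Literature.NumberTheory.Transcendental.Tubbs1990_thm4_periods_holds :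
    Literature.NumberTheory.Transcendental.Tubbs1990_thm4_periods :=
  Literature.NumberTheory.Transcendental.TubbsPeriods.Tubbs1990_thm4_periods_holds

end
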